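import Mathlib
import Summits.Schanuel.Schanuel.Theorems.RootDecomp1EModuleType
import Summits.Schanuel.Schanuel.Theorems.RootDecomp1EModuleGrids
import Summits.Schanuel.Schanuel.Theorems.RootDecomp1EModuleGridsSharp
import Literature.Barriers.Schanuel.LargeTranscendenceDegree

-- `Summit.Schanuel.Schanuel.…` is the mandated layout of this single-problem summit (CONVENTIONS §1).
set_option linter.dupNamespace false

/-!
# RootDecomp1E — lens 2, gen 9 «ModuleType» (part 2/2): the engines bite a rich field AT EVERY LENGTH;
# decided layers; the live residual's first open layer is the POOR class

Port of §6–§8b of `HOME/decomp-schanuel-lens-2/g9/ModuleType.lean` (`--supports stmt-Schanuel-31410`).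
* §6 `ModuleRich z ⟹ 2 ≤ trdeg F_z` (`two_le_trdeg_of_moduleRich`), each of the four clauses through the
  corresponding clause of the PROVED tree facts `Literature.Barriers.Schanuel.smallTrdeg_thm_2_9_pos` /
  `smallTrdeg_thm_2_9_two_two` (carried as hypotheses `h29` / `hBW`: their proof cones are not built on the
  farm), by monotonicity of `trdeg` under algebraic extension; vacuity guard `not_moduleRich_one` (`z = (1)`
  is poor).
* §7 DECIDED LAYERS: `RichDefectOneAt n` holds for `n ≤ 3` (`richDefectOneAt_le_three`), `PoorDefectOneAt n`
  for `n ≤ 2`; at `n = 4` a rich first failure has defect `≤ 2` for free.  HEADLINE for stmt-31410: its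
  first open layer `n = 3` («S⁻ on plain ℚ-free triples», round 8 `plainDefectOne_three_iff`) is
  EQUIVALENT to `PoorDefectOneAt 3` = «S⁻ on module-poor ℚ-free triples» (`plainLayer_three_iff_poorAt_three`),
  a strictly smaller class: round 8's `z♯` is plain but rich (§8b, `moduleRich_zSharp`).
* §8 twisted log pairs are rich; §8b the literal certificates at `z♯`.
Sorry-free; axioms `propext`, `Classical.choice`, `Quot.sound`.
[cite: NesterenkoPhilippon2001, Ch. 14 Theorem 2.9] [cite: BakerTNT1975, Ch. 12 Theorem 12.2]
-/

noncomputable section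

namespace Summit.Schanuel.Schanuel.Theorems.RootDecomp1EModuleType

open Complex IntermediateField
open Summit.Schanuel.Schanuel.Theses.RootDecomp1E (DefectOneSchanuel EStableDefectOne PlainDefectOne
  ClosedFormAtomSchanuel AlgAnchoredDarkAtomSchanuel LineLogDarkAtomSchanuel DeepLogDarkAtomSchanuel
  OffAxisClosure FreeDarkAtomSchanuel)
open Summit.Schanuel.Schanuel.Theorems.RootDecomp1EAnchor (isAlgebraic_of_mem_adjoin
  trdeg_adjoin_le_of_isAlgebraic mem_adjoin_of_mem_span exp_isAlgebraic_of_mem_span isAlgebraic_transfer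
  trdeg_adjoin_le_nat)
open Summit.Schanuel.Schanuel.Theorems.RootDecomp1EEStableRung (defectOne_of_le_two one_beta_linearIndependent)
open Summit.Schanuel.Schanuel.Theorems.RootDecomp1EModuleGrids (two_le_trdeg_of_t2Module subMinimal_three
  L2 P zSharp zSharp_linearIndependent zSharp_multiplier_rational zSharp_subMinimal P_mem_adjoin_zSharp
  zSharp_one_mem_span zSharp_two_mem_span linearIndependent_L2_PI linearIndependent_one_P isAlgebraic_exp_L2
  isAlgebraic_exp_P_mul_I)
open Literature.Barriers.Schanuel (gridExp gridField gridField₁ gridField₂ smallTrdeg_thm_2_9_pos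
  smallTrdeg_thm_2_9_two_two)

/-! ## §6 The engines bite the rich module AT EVERY LENGTH: `ModuleRich z ⟹ 2 ≤ trdeg F_z` -/

/-- **Module form of the `t₀`-clause of Theorem 2.9**: `dℓ ≥ 2(ℓ + d)` exponentials `e^{xᵢyⱼ}` of a free
rank-one grid, merely ALGEBRAIC OVER `F_z` (the `xᵢ`, `yⱼ` themselves arbitrary), force `2 ≤ trdeg F_z`.
[cite: NesterenkoPhilippon2001, Ch. 14 Theorem 2.9 (t ≥ 2)] -/
theorem two_le_trdeg_of_t0Module (h29 : smallTrdeg_thm_2_9_pos) {ι : Type*} (z : ι → ℂ) {d l : ℕ}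
    (x : Fin d → ℂ) (y : Fin l → ℂ) (hd : 0 < d) (hx : LinearIndependent ℚ x) (hy : LinearIndependent ℚ y)
    (h0 : 2 * (l + d) ≤ d * l)
    (heF : ∀ i j, IsAlgebraic ↥(adjoin ℚ (Set.range z ∪ Set.range (cexp ∘ z))) (cexp (x i * y j))) :
    (2 : Cardinal) ≤ Algebra.trdeg ℚ ↥(adjoin ℚ (Set.range z ∪ Set.range (cexp ∘ z))) := by
  have hl : 0 < l := by
    rcases Nat.eq_zero_or_pos l with rfl | hl
    · omega
    · exact hl
  refine ((h29 d l x y hd hl hx hy).1 h0).trans ?_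
  show Algebra.trdeg ℚ ↥(adjoin ℚ (Set.range (gridExp x y))) ≤ _
  apply trdeg_adjoin_le_of_isAlgebraic
  rintro t ⟨⟨i, j⟩, rfl⟩
  exact heF i j

/-- **Module form of the `t₁`-clause of Theorem 2.9**: `dℓ ≥ d + 2ℓ`, the `xᵢ` and the `e^{xᵢyⱼ}` algebraic
over `F_z` (the `yⱼ` arbitrary) force `2 ≤ trdeg F_z`. [cite: NesterenkoPhilippon2001, Ch. 14 Theorem 2.9 (t₁ ≥ 2)] -/
theorem two_le_trdeg_of_t1Module (h29 : smallTrdeg_thm_2_9_pos) {ι : Type*} (z : ι → ℂ) {d l : ℕ}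
    (x : Fin d → ℂ) (y : Fin l → ℂ) (hd : 0 < d) (hx : LinearIndependent ℚ x) (hy : LinearIndependent ℚ y)
    (h1 : d + 2 * l ≤ d * l)
    (hxF : ∀ i, IsAlgebraic ↥(adjoin ℚ (Set.range z ∪ Set.range (cexp ∘ z))) (x i))
    (heF : ∀ i j, IsAlgebraic ↥(adjoin ℚ (Set.range z ∪ Set.range (cexp ∘ z))) (cexp (x i * y j))) :
    (2 : Cardinal) ≤ Algebra.trdeg ℚ ↥(adjoin ℚ (Set.range z ∪ Set.range (cexp ∘ z))) := by
  have hl : 0 < l := by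
    rcases Nat.eq_zero_or_pos l with rfl | hl
    · omega
    · exact hl
  refine ((h29 d l x y hd hl hx hy).2.1 h1).trans ?_
  show Algebra.trdeg ℚ ↥(adjoin ℚ (Set.range x ∪ Set.range (gridExp x y))) ≤ _
  apply trdeg_adjoin_le_of_isAlgebraic
  rintro t (⟨i, rfl⟩ | ⟨⟨i, j⟩, rfl⟩)
  · exact hxF i
  · exact heF i j

/-- Brownawell–Waldschmidt in module form with a general first row (round 8 §1 had `x = (1, μ)`). -/
theorem two_le_trdeg_of_bwRow (hBW : smallTrdeg_thm_2_9_two_two) {ι : Type*} (z : ι → ℂ)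
    (x y : Fin 2 → ℂ) (hx : LinearIndependent ℚ x) (hy : LinearIndependent ℚ y)
    (h0 : IsAlgebraic ℚ (cexp (x 0 * y 0))) (h1 : IsAlgebraic ℚ (cexp (x 0 * y 1)))
    (hxF : ∀ i, IsAlgebraic ↥(adjoin ℚ (Set.range z ∪ Set.range (cexp ∘ z))) (x i))
    (hyF : ∀ j, IsAlgebraic ↥(adjoin ℚ (Set.range z ∪ Set.range (cexp ∘ z))) (y j))
    (heF : ∀ i j, IsAlgebraic ↥(adjoin ℚ (Set.range z ∪ Set.range (cexp ∘ z))) (cexp (x i * y j))) :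
    (2 : Cardinal) ≤ Algebra.trdeg ℚ ↥(adjoin ℚ (Set.range z ∪ Set.range (cexp ∘ z))) := by
  refine (hBW x y hx hy h0 h1).trans ?_
  show Algebra.trdeg ℚ ↥(adjoin ℚ (Set.range x ∪ Set.range y ∪
      Set.range (fun p : Fin 2 × Fin 2 => cexp (x p.1 * y p.2)))) ≤ _
  apply trdeg_adjoin_le_of_isAlgebraic
  rintro t ((⟨i, rfl⟩ | ⟨j, rfl⟩) | ⟨⟨i, j⟩, rfl⟩)
  · exact hxF i
  · exact hyF j
  · exact heF i j

/-- **RICH ⟹ `trdeg F_z ≥ 2`**, whatever the length of `z` (mod the two PROVED tree facts, carried as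
hypotheses only because their proof cones were unbuilt on the farm at writing time). -/
theorem two_le_trdeg_of_moduleRich (hBW : smallTrdeg_thm_2_9_two_two) (h29 : smallTrdeg_thm_2_9_pos)
    {ι : Type*} (z : ι → ℂ) (hz : ModuleRich z) :
    (2 : Cardinal) ≤ Algebra.trdeg ℚ ↥(adjoin ℚ (Set.range z ∪ Set.range (cexp ∘ z))) := by
  unfold ModuleRich at hz
  obtain ⟨d, l, x, y, hd, hx, hy, heF, h0 | ⟨h1, hxF⟩ | ⟨h2, hxF, hyF⟩ | ⟨rfl, rfl, hxF, hyF, i, hi⟩⟩ := hz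
  · exact two_le_trdeg_of_t0Module h29 z x y hd hx hy h0 heF
  · exact two_le_trdeg_of_t1Module h29 z x y hd hx hy h1 hxF heF
  · exact two_le_trdeg_of_t2Module h29 z x y hx hy h2 hxF hyF heF
  · fin_cases i
    · exact two_le_trdeg_of_bwRow hBW z x y hx hy (hi 0) (hi 1) hxF hyF heF
    · -- swap the two rows so that the row with algebraic exponentials comes first
      have hsw : LinearIndependent ℚ ![x 1, x 0] := by
        have e : ![x 1, x 0] = x ∘ ⇑(Equiv.swap (0 : Fin 2) 1) := by
          funext k
          fin_cases k
          · simp [Equiv.swap_apply_left]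
          · simp [Equiv.swap_apply_right]
        rw [e]
        exact hx.comp _ (Equiv.injective _)
      refine two_le_trdeg_of_bwRow hBW z ![x 1, x 0] y hsw hy (by simpa using hi 0) (by simpa using hi 1)
        ?_ hyF ?_
      · intro k
        fin_cases k
        · simpa using hxF 1
        · simpa using hxF 0
      · intro k j
        fin_cases k
        · simpa using heF 1 j
        · simpa using heF 0 j

/-- A field of transcendence degree `≤ 1` is MODULE-POOR; so the rich predicate is a genuine restriction
(typing note: the conjunct `0 < d` is load-bearing — without it `(d, ℓ) = (0, 0)` would satisfy the
`t₀`/`t₁` numerologies vacuously and make every tuple «rich»). -/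
theorem not_moduleRich_of_trdeg_le_one (hBW : smallTrdeg_thm_2_9_two_two) (h29 : smallTrdeg_thm_2_9_pos)
    {ι : Type*} (z : ι → ℂ)
    (h1 : Algebra.trdeg ℚ ↥(adjoin ℚ (Set.range z ∪ Set.range (cexp ∘ z))) ≤ 1) : ¬ ModuleRich z := by
  intro h
  have h21 : (2 : Cardinal) ≤ 1 := (two_le_trdeg_of_moduleRich hBW h29 z h).trans h1
  norm_num at h21

/-- VACUITY GUARD, certified member of the poor class: `z = (1)` (`trdeg ℚ(1, e) = trdeg ℚ(e) ≤ 1`). -/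
theorem not_moduleRich_one (hBW : smallTrdeg_thm_2_9_two_two) (h29 : smallTrdeg_thm_2_9_pos) :
    ¬ ModuleRich ![(1 : ℂ)] := by
  have hK : Algebra.trdeg ℚ ↥(adjoin ℚ ({cexp 1} : Set ℂ)) ≤ ((1 : ℕ) : Cardinal) :=
    trdeg_adjoin_le_nat (F := ℚ) ({cexp 1} : Set ℂ) (n := 1)
      (by rw [Nat.cast_one]; exact Cardinal.mk_le_one_iff_set_subsingleton.mpr Set.subsingleton_singleton)
  have halg : ∀ t ∈ Set.range ![(1 : ℂ)] ∪ Set.range (cexp ∘ ![(1 : ℂ)]),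
      IsAlgebraic ↥(adjoin ℚ ({cexp 1} : Set ℂ)) t := by
    rintro t (⟨i, rfl⟩ | ⟨i, rfl⟩)
    · have hi : i = 0 := Subsingleton.elim _ _
      subst hi
      simpa using (isAlgebraic_one : IsAlgebraic ℚ (1 : ℂ)).tower_top (L := ↥(adjoin ℚ ({cexp 1} : Set ℂ)))
    · have hi : i = 0 := Subsingleton.elim _ _
      subst hi
      simpa using isAlgebraic_of_mem_adjoin (mem_adjoin_simple_self ℚ (cexp 1))
  have hF := (trdeg_adjoin_le_of_isAlgebraic halg).trans hK
  rw [Nat.cast_one] at hF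
  exact not_moduleRich_of_trdeg_le_one hBW h29 _ hF

/-! ## §7 Decided layers: rich for `n ≤ 3`, poor for `n ≤ 2`; the live residual's first open layer -/

/-- **THE DECIDED LAYERS of the rich side**: `S⁻` holds at every module-rich ℚ-free tuple of length `≤ 3`
(lengths `≤ 2`: Hermite–Lindemann; length 3: `trdeg ≥ 2 = n − 1` by §6).  No sub-minimality needed. -/
theorem richLayer_le_three (hBW : smallTrdeg_thm_2_9_two_two) (h29 : smallTrdeg_thm_2_9_pos) :
    ∀ (n : ℕ), n ≤ 3 → ∀ (z : Fin n → ℂ), LinearIndependent ℚ z → ModuleRich z →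
      (n : Cardinal) ≤ Algebra.trdeg ℚ ↥(IntermediateField.adjoin ℚ (Set.range z ∪ Set.range (Complex.exp ∘ z))) + 1 := by
  intro n hn z hz hrich
  rcases Nat.lt_or_ge n 3 with h | h
  · exact defectOne_of_le_two n (by omega) z hz
  · obtain rfl : n = 3 := le_antisymm hn h
    have h2 := two_le_trdeg_of_moduleRich hBW h29 z hrich
    have h3 : (2 : Cardinal) + 1 ≤
        Algebra.trdeg ℚ ↥(adjoin ℚ (Set.range z ∪ Set.range (cexp ∘ z))) + 1 := add_le_add h2 le_rfl
    have h21 : (2 : Cardinal) + 1 = 3 := by norm_num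
    rw [h21] at h3
    exact_mod_cast h3

/-- The rich piece is DECIDED at every length `n ≤ 3` (mod hBW / h29): a module-rich field has trdeg ≥ 2. -/
theorem richDefectOneAt_le_three (hBW : smallTrdeg_thm_2_9_two_two) (h29 : smallTrdeg_thm_2_9_pos)
    (n : ℕ) (hn : n ≤ 3) : RichDefectOneAt n :=
  fun z hz hrich _ => richLayer_le_three hBW h29 n hn z hz hrich

/-- So the open part of the rich side STARTS AT `n = 4`. -/
theorem richAt_all_iff_from_four (hBW : smallTrdeg_thm_2_9_two_two) (h29 : smallTrdeg_thm_2_9_pos) :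
    (∀ n, RichDefectOneAt n) ↔ ∀ n, 4 ≤ n → RichDefectOneAt n := by
  refine ⟨fun h n _ => h n, fun h n => ?_⟩
  rcases Nat.lt_or_ge n 4 with h4 | h4
  · exact richDefectOneAt_le_three hBW h29 n (by omega)
  · exact h n h4

/-- At the first open length `n = 4` a rich field has defect `≤ 2` for free (`trdeg ≥ 2`): the item asks
for exactly ONE more algebraically independent element of `ℚ(z, e^z)`. -/
theorem rich_four_le_trdeg_add_two (hBW : smallTrdeg_thm_2_9_two_two) (h29 : smallTrdeg_thm_2_9_pos)
    (z : Fin 4 → ℂ) (hrich : ModuleRich z) :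
    ((4 : ℕ) : Cardinal) ≤ Algebra.trdeg ℚ ↥(adjoin ℚ (Set.range z ∪ Set.range (cexp ∘ z))) + 2 := by
  have h2 := two_le_trdeg_of_moduleRich hBW h29 z hrich
  have h3 : (2 : Cardinal) + 2 ≤
      Algebra.trdeg ℚ ↥(adjoin ℚ (Set.range z ∪ Set.range (cexp ∘ z))) + 2 := add_le_add h2 le_rfl
  have h22 : (2 : Cardinal) + 2 = 4 := by norm_num
  rwa [h22] at h3

/-- The poor layers hold for `n ≤ 2` (Hermite–Lindemann); the residual's open part STARTS AT `n = 3`. -/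
theorem poorDefectOneAt_le_two (n : ℕ) (hn : n ≤ 2) : PoorDefectOneAt n :=
  fun z hz _ _ => defectOne_of_le_two n hn z hz

/-- The poor piece holds at all lengths iff it holds from length 3 on (lengths ≤ 2 are free). -/
theorem poorAt_all_iff_from_three : (∀ n, PoorDefectOneAt n) ↔ ∀ n, 3 ≤ n → PoorDefectOneAt n := by
  refine ⟨fun h n _ => h n, fun h n => ?_⟩
  rcases Nat.lt_or_ge n 3 with h3 | h3
  · exact poorDefectOneAt_le_two n (by omega)
  · exact h n h3

/-- The `n = 3` poor layer without the (automatic) sub-minimality hypothesis. -/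
theorem poorDefectOneAt_three_iff :
    PoorDefectOneAt 3 ↔
      ∀ z : Fin 3 → ℂ, LinearIndependent ℚ z → ¬ ModuleRich z →
        ((3 : ℕ) : Cardinal) ≤ Algebra.trdeg ℚ ↥(IntermediateField.adjoin ℚ (Set.range z ∪ Set.range (Complex.exp ∘ z))) + 1 :=
  ⟨fun h z hz hp => h z hz hp (subMinimal_three z), fun h z hz hp _ => h z hz hp⟩

/-- **HEADLINE for stmt-Schanuel-31410.**  The live residual's first open layer — `S⁻` on PLAIN ℚ-free
triples (round 8 `plainDefectOne_three_iff`) — is EQUIVALENT (mod the two proved tree facts) to `S⁻` on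
MODULE-POOR ℚ-free triples: plain-but-rich triples (e.g. `z♯`, `z★`) are decided by §6, and poor triples
are plain (§4).  The open content of 31410 at `n = 3` is exactly the engine-dark class. -/
theorem plainLayer_three_iff_poorAt_three (hBW : smallTrdeg_thm_2_9_two_two) (h29 : smallTrdeg_thm_2_9_pos) :
    (∀ z : Fin 3 → ℂ, LinearIndependent ℚ z →
      (∀ β : ℂ, IsAlgebraic ℚ β → (∀ i, β * z i ∈ Submodule.span ℚ (Set.range z)) →
        β ∈ Set.range (algebraMap ℚ ℂ)) →
      SubMinimalDefect 3 z → ((3 : ℕ) : Cardinal) ≤ Algebra.trdeg ℚ ↥(IntermediateField.adjoin ℚ (Set.range z ∪ Set.range (Complex.exp ∘ z))) + 1) ↔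
    PoorDefectOneAt 3 := by
  refine ⟨fun h z hz hpoor hsub => h z hz (plain_of_not_moduleRich le_rfl hz hpoor) hsub,
    fun h z hz _ hsub => ?_⟩
  by_cases hrich : ModuleRich z
  · exact richLayer_le_three hBW h29 3 le_rfl z hz hrich
  · exact h z hz hrich hsub

/-- Global form: `PlainDefectOne` (31410) ⟺ its rich-plain layers from `n = 4` on ∧ all poor layers from
`n = 3` on — the poor layers being the declared residual of round 9. -/
theorem plainDefectOne_iff_richPlain_from_four_and_poorAt (hBW : smallTrdeg_thm_2_9_two_two)
    (h29 : smallTrdeg_thm_2_9_pos) :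
    PlainDefectOne ↔
      (∀ n, 4 ≤ n → ∀ z : Fin n → ℂ, LinearIndependent ℚ z →
        (∀ β : ℂ, IsAlgebraic ℚ β → (∀ i, β * z i ∈ Submodule.span ℚ (Set.range z)) →
          β ∈ Set.range (algebraMap ℚ ℂ)) →
        ModuleRich z → SubMinimalDefect n z → (n : Cardinal) ≤ Algebra.trdeg ℚ ↥(IntermediateField.adjoin ℚ (Set.range z ∪ Set.range (Complex.exp ∘ z))) + 1) ∧
      (∀ n, 3 ≤ n → PoorDefectOneAt n) := by
  constructor
  · intro hP
    exact ⟨fun n _ z hz hpl _ hsub => hP n z hz hpl hsub,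
      fun n _ => poorAt_of_plainDefectOne hP n⟩
  · rintro ⟨hR, hPo⟩ n z hz hpl hsub
    by_cases hrich : ModuleRich z
    · rcases Nat.lt_or_ge n 4 with h4 | h4
      · exact richLayer_le_three hBW h29 n (by omega) z hz hrich
      · exact hR n h4 z hz hpl hrich hsub
    · rcases Nat.lt_or_ge n 3 with h3 | h3
      · exact defectOne_of_le_two n (by omega) z hz
      · exact hPo n h3 z hz hrich hsub

/-! ## §8 The B–W cells of round 8 are module-rich (so `Poor ⊊ Pl` as classes at `n = 3`) -/

/-- **TWISTED LOG PAIRS ARE MODULE-RICH**: if `span_ℚ z ∋ μ l₁, μ l₂` with `(l₁, l₂)`, `(1, μ)` ℚ-free,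
`e^{l₁}, e^{l₂} ∈ ℚ̄` and `μ ∈ F_z`, then `x = (1, μ)`, `y = (l₁, l₂)` is a BW grid in `Λ(F_z)` (the corners
`l_j = (μ l_j)/μ` need not lie in the span: round 8, `iπ ∉ span z★`).  With round 8's certificates this makes
`z♯`, `z★` PLAIN members of the RICH class — the witnesses that the residual shrank strictly at `n = 3`. -/
theorem moduleRich_of_twistedLogPair {ι : Type*} (z : ι → ℂ) (l₁ l₂ μ : ℂ)
    (hl : LinearIndependent ℚ ![l₁, l₂]) (hμ : LinearIndependent ℚ ![(1 : ℂ), μ])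
    (ha₁ : IsAlgebraic ℚ (cexp l₁)) (ha₂ : IsAlgebraic ℚ (cexp l₂))
    (hμF : μ ∈ adjoin ℚ (Set.range z ∪ Set.range (cexp ∘ z)))
    (h₁ : μ * l₁ ∈ Submodule.span ℚ (Set.range z)) (h₂ : μ * l₂ ∈ Submodule.span ℚ (Set.range z)) :
    ModuleRich z := by
  set F : IntermediateField ℚ ℂ := adjoin ℚ (Set.range z ∪ Set.range (cexp ∘ z)) with hF
  have hμ0 : μ ≠ 0 := by simpa using hμ.ne_zero 1
  have hl₁F : l₁ ∈ F := by
    have : l₁ = (μ * l₁) * μ⁻¹ := by field_simp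
    rw [this]
    exact mul_mem (mem_adjoin_of_mem_span h₁) (inv_mem hμF)
  have hl₂F : l₂ ∈ F := by
    have : l₂ = (μ * l₂) * μ⁻¹ := by field_simp
    rw [this]
    exact mul_mem (mem_adjoin_of_mem_span h₂) (inv_mem hμF)
  unfold ModuleRich
  refine ⟨2, 2, ![(1 : ℂ), μ], ![l₁, l₂], by norm_num, hμ, hl, ?_,
    Or.inr (Or.inr (Or.inr ⟨rfl, rfl, ?_, ?_, 0, ?_⟩))⟩
  · intro i j
    fin_cases i <;> fin_cases j
    · simpa using ha₁.tower_top (L := ↥F)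
    · simpa using ha₂.tower_top (L := ↥F)
    · simpa using exp_isAlgebraic_of_mem_span (z := z) h₁
    · simpa using exp_isAlgebraic_of_mem_span (z := z) h₂
  · intro i
    fin_cases i
    · simpa using (isAlgebraic_one : IsAlgebraic ℚ (1 : ℂ)).tower_top (L := ↥F)
    · simpa using isAlgebraic_of_mem_adjoin hμF
  · intro j
    fin_cases j
    · simpa using isAlgebraic_of_mem_adjoin hl₁F
    · simpa using isAlgebraic_of_mem_adjoin hl₂F
  · intro j
    fin_cases j
    · simpa using ha₁
    · simpa using ha₂

/-! ## §8b LITERAL certificates at `z♯ = (log 2, π·log 2, iπ²)` (tree `RootDecomp1EModuleGridsSharp`) -/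

/-- **`z♯` is MODULE-RICH** (twisted log pair `l = (log 2, iπ)`, `μ = π ∈ F_{z♯}`) — hypothesis-free. -/
theorem moduleRich_zSharp : ModuleRich zSharp :=
  moduleRich_of_twistedLogPair zSharp L2 (P * I) P linearIndependent_L2_PI linearIndependent_one_P
    isAlgebraic_exp_L2 isAlgebraic_exp_P_mul_I P_mem_adjoin_zSharp zSharp_one_mem_span zSharp_two_mem_span

/-- **`z♯` is a LITERAL member of round 7's residual class (ℚ-free, PLAIN, sub-minimal) OUTSIDE the round-9
residual class**: the poor class is strictly smaller than the plain class at the first open length `n = 3`. -/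
theorem zSharp_plain_not_poor :
    LinearIndependent ℚ zSharp ∧
    (∀ β : ℂ, IsAlgebraic ℚ β → (∀ i, β * zSharp i ∈ Submodule.span ℚ (Set.range zSharp)) →
      β ∈ Set.range (algebraMap ℚ ℂ)) ∧
    SubMinimalDefect 3 zSharp ∧ ¬ ¬ ModuleRich zSharp :=
  ⟨zSharp_linearIndependent, fun β _ hβ => zSharp_multiplier_rational β hβ, zSharp_subMinimal,
    not_not_intro moduleRich_zSharp⟩

/-- LITERAL LAYER TEST: the rich layer's conclusion AT `z♯`, by the decided layer (mod the two tree facts). -/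
theorem richLayer_at_zSharp (hBW : smallTrdeg_thm_2_9_two_two) (h29 : smallTrdeg_thm_2_9_pos) :
    ((3 : ℕ) : Cardinal) ≤ Algebra.trdeg ℚ ↥(IntermediateField.adjoin ℚ
      (Set.range zSharp ∪ Set.range (Complex.exp ∘ zSharp))) + 1 :=
  richLayer_le_three hBW h29 3 le_rfl zSharp zSharp_linearIndependent moduleRich_zSharp

/-! ## §9 Sanity: with the split, the LIVE seven-binder `RootDecomp1E.closes` (rev 23) decides `Schanuel` -/

example (hR : ∀ n, RichDefectOneAt n) (hP : ∀ n, PoorDefectOneAt n) (hC : ClosedFormAtomSchanuel)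
    (hAlg : AlgAnchoredDarkAtomSchanuel) (hLine : LineLogDarkAtomSchanuel) (hDeep : DeepLogDarkAtomSchanuel)
    (hOff : OffAxisClosure) (hF : FreeDarkAtomSchanuel) : _root_.Schanuel :=
  Summit.Schanuel.Schanuel.Theses.RootDecomp1E.closes (defectOne_of_richAt_of_poorAt hR hP)
    hC hAlg hLine hDeep hOff hF

end Summit.Schanuel.Schanuel.Theorems.RootDecomp1EModuleType

end
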